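import Literature.Geometry.DiscreteGeometry.TwoShellIntegerModel

/-!
# NODE g79 «CompressedCut», toward the open leaf NS♭₂ — CHAIN TRANSPORT: frames and positions along a registered chain (fifth brick of the FRAME half)

Route `OverbindingBudget` (Crystallization), crux `RobustDefectLimitWindows` (stmt-AtomisticToContinuum-31280), decomp-a2c lens 4, generation 79, ADDENDUM 8.
Companions: `…CompressedCutOp` (ONE transport step: `transport_step_exists`, additive composition `transport_compose`), `…CompressedCutDict` / `…Classes` /
`…Transfer` / `…Scale` (the data of one step).  This file is the INDUCTION of step (F-e) of memo NODE-g79 §5 in abstract form — scaled frames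
`G t : ℝ³ →ₗ ℝ³` (`= nn_{j_t}·A_{j_t}`) along a chain `j_0 = i, j_1, …`, positions `y t`, registered unit steps `v t`:

* §1 ★ `transport_chain`: if every step admits an exact isometry `R` with `‖G (t+1) x − G t (R x)‖ ≤ η t·‖x‖` for all `x`, then for every `L` there is an exact
  isometry `R_L` with `‖G L x − G 0 (R_L x)‖ ≤ (Σ_{t<L} η t)·‖x‖` — transport errors ADD along the chain (no re-coordinatisation); `transport_chain_const`;
* §2 ★ `position_chain`: if moreover `‖(y (t+1) − y t) − G t (v t)‖ ≤ κ t` (registered steps) with `‖v t‖ ≤ 1` and frames `G t` are transported from `G 0` with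
  op-error `δ t` through maps `R t`, then `‖(y L − y 0) − G 0 (Σ_{t<L} R t (v t))‖ ≤ Σ_{t<L} (κ t + δ t)`: the site at chain length `L` sits at the `G 0`-image of
  the TRANSPORTED LETTER SUM `Σ_{t<L} R t (v t)` up to an additive error — the strained-Barlow position of memo §5;
* §3 `norm_sub_norm_le_of_transport`: distances from the base site are read off the transported frame up to `δ·‖x‖`;
* §4 ★ `transport_positions` (frames and positions together, via `choose`) and ★★ `chain_budget_const`: with constant per-step errors `η`, `κ` there are exact
  isometries `R t` with frame op-error `t·η` and position error `L·κ + (L²/2)·η` at chain length `L` (`sum_const_add_linear_le`) — the budget of memo §5.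

Deps: tree only (`Literature.Geometry.DiscreteGeometry.TwoShellIntegerModel`, for the ambient imports).  No `instance`, no `notation`, no `set_option`,
no new axioms, 0 sorry.
-/

namespace Summit.AtomisticToContinuum.Crystallization.Theorems.OverbindingBudgetAffineCompressedCutChain

open Finset

/-! ## §1  Frame transport along a chain: errors add -/

/-- ★ **CHAIN TRANSPORT of frames.**  Per-step exact isometries with op-errors `η t` compose to an exact isometry with op-error `Σ_{t<L} η t`. [this file] -/
theorem transport_chain {G : ℕ → (EuclideanSpace ℝ (Fin 3) →ₗ[ℝ] EuclideanSpace ℝ (Fin 3))} {η : ℕ → ℝ}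
    (hstep : ∀ t, ∃ R : EuclideanSpace ℝ (Fin 3) →ₗᵢ[ℝ] EuclideanSpace ℝ (Fin 3), ∀ x, ‖G (t + 1) x - G t (R x)‖ ≤ η t * ‖x‖) :
    ∀ L, ∃ R : EuclideanSpace ℝ (Fin 3) →ₗᵢ[ℝ] EuclideanSpace ℝ (Fin 3), ∀ x, ‖G L x - G 0 (R x)‖ ≤ (∑ t ∈ range L, η t) * ‖x‖ := by
  intro L
  induction L with
  | zero =>
    refine ⟨LinearIsometry.id, fun x => ?_⟩
    simp
  | succ L ih =>
    obtain ⟨R, hR⟩ := ih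
    obtain ⟨R₁, hR₁⟩ := hstep L
    refine ⟨R.comp R₁, fun x => ?_⟩
    have h1 := hR₁ x
    have h2 := hR (R₁ x)
    rw [LinearIsometry.norm_map] at h2
    have e : G (L + 1) x - G 0 ((R.comp R₁) x) = (G (L + 1) x - G L (R₁ x)) + (G L (R₁ x) - G 0 (R (R₁ x))) := by
      rw [LinearIsometry.coe_comp, Function.comp_apply]; abel
    rw [e, sum_range_succ]
    have h3 := norm_add_le (G (L + 1) x - G L (R₁ x)) (G L (R₁ x) - G 0 (R (R₁ x)))
    nlinarith [h1, h2, h3, norm_nonneg x]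

/-- Constant per-step error: op-error `L·η` after `L` steps. [this file] -/
theorem transport_chain_const {G : ℕ → (EuclideanSpace ℝ (Fin 3) →ₗ[ℝ] EuclideanSpace ℝ (Fin 3))} {η : ℝ}
    (hstep : ∀ t, ∃ R : EuclideanSpace ℝ (Fin 3) →ₗᵢ[ℝ] EuclideanSpace ℝ (Fin 3), ∀ x, ‖G (t + 1) x - G t (R x)‖ ≤ η * ‖x‖) (L : ℕ) :
    ∃ R : EuclideanSpace ℝ (Fin 3) →ₗᵢ[ℝ] EuclideanSpace ℝ (Fin 3), ∀ x, ‖G L x - G 0 (R x)‖ ≤ L * η * ‖x‖ := by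
  obtain ⟨R, hR⟩ := transport_chain (η := fun _ => η) hstep L
  refine ⟨R, fun x => ?_⟩
  have := hR x
  simpa [sum_const, card_range, nsmul_eq_mul] using this

/-! ## §2  Positions along a registered chain: the transported letter sum -/

/-- ★ **CHAIN TRANSPORT of positions.**  Registered steps `‖(y (t+1) − y t) − G t (v t)‖ ≤ κ t` with `‖v t‖ ≤ 1`, and frames transported from the base,
`‖G t x − G 0 (R t x)‖ ≤ δ t·‖x‖` for all `x` (`R t` any maps, e.g. the isometries of `transport_chain`), give
`‖(y L − y 0) − G 0 (Σ_{t<L} R t (v t))‖ ≤ Σ_{t<L} (κ t + δ t)`. [this file] -/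
theorem position_chain {G : ℕ → (EuclideanSpace ℝ (Fin 3) →ₗ[ℝ] EuclideanSpace ℝ (Fin 3))}
    {R : ℕ → (EuclideanSpace ℝ (Fin 3) → EuclideanSpace ℝ (Fin 3))}
    {y v : ℕ → EuclideanSpace ℝ (Fin 3)} {κ δ : ℕ → ℝ}
    (hreg : ∀ t, ‖(y (t + 1) - y t) - G t (v t)‖ ≤ κ t) (hv : ∀ t, ‖v t‖ ≤ 1)
    (hframe : ∀ t x, ‖G t x - G 0 (R t x)‖ ≤ δ t * ‖x‖) :
    ∀ L, ‖(y L - y 0) - G 0 (∑ t ∈ range L, R t (v t))‖ ≤ ∑ t ∈ range L, (κ t + δ t) := by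
  intro L
  induction L with
  | zero => simp
  | succ L ih =>
    have h1 := hreg L
    have h2 := hframe L (v L)
    have hδ : 0 ≤ δ L := by
      have hu := hframe L (EuclideanSpace.single 0 1)
      rw [EuclideanSpace.single, PiLp.norm_single, norm_one, mul_one] at hu
      exact (norm_nonneg _).trans hu
    have h2' : ‖G L (v L) - G 0 (R L (v L))‖ ≤ δ L := by
      have hb := mul_le_mul_of_nonneg_left (hv L) hδ
      rw [mul_one] at hb
      exact h2.trans hb
    have e : (y (L + 1) - y 0) - G 0 (∑ t ∈ range (L + 1), R t (v t))
        = ((y L - y 0) - G 0 (∑ t ∈ range L, R t (v t))) + ((y (L + 1) - y L) - G L (v L)) + (G L (v L) - G 0 (R L (v L))) := by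
      rw [sum_range_succ, map_add]; abel
    rw [e, sum_range_succ]
    have n1 := norm_add_le (((y L - y 0) - G 0 (∑ t ∈ range L, R t (v t))) + ((y (L + 1) - y L) - G L (v L))) (G L (v L) - G 0 (R L (v L)))
    have n2 := norm_add_le ((y L - y 0) - G 0 (∑ t ∈ range L, R t (v t))) ((y (L + 1) - y L) - G L (v L))
    linarith

/-! ## §3  Reading distances off the transported frame -/

/-- Distances from the base site are read off the transported frame: `|‖G t x‖ − ‖G 0 (R x)‖| ≤ δ·‖x‖`. [this file] -/
theorem norm_sub_norm_le_of_transport {G₀ Gt : EuclideanSpace ℝ (Fin 3) →ₗ[ℝ] EuclideanSpace ℝ (Fin 3)}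
    {R : EuclideanSpace ℝ (Fin 3) → EuclideanSpace ℝ (Fin 3)} {δ : ℝ} (h : ∀ x, ‖Gt x - G₀ (R x)‖ ≤ δ * ‖x‖) (x : EuclideanSpace ℝ (Fin 3)) :
    |‖Gt x‖ - ‖G₀ (R x)‖| ≤ δ * ‖x‖ :=
  (abs_norm_sub_norm_le (Gt x) (G₀ (R x))).trans (h x)

/-! ## §4  The combined chain estimate and its record budget -/

/-- ★ **FRAMES AND POSITIONS TOGETHER.**  Per-step isometric transport with op-errors `η t`, registered unit steps with errors `κ t`: there are exact isometries
`R t` (frame of site `t` relative to the base) with `‖G t x − G 0 (R t x)‖ ≤ (Σ_{s<t} η s)·‖x‖` and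
`‖(y L − y 0) − G 0 (Σ_{t<L} R t (v t))‖ ≤ Σ_{t<L} (κ t + Σ_{s<t} η s)` for every `L`. [this file] -/
theorem transport_positions {G : ℕ → (EuclideanSpace ℝ (Fin 3) →ₗ[ℝ] EuclideanSpace ℝ (Fin 3))} {η κ : ℕ → ℝ}
    {y v : ℕ → EuclideanSpace ℝ (Fin 3)}
    (hstep : ∀ t, ∃ R : EuclideanSpace ℝ (Fin 3) →ₗᵢ[ℝ] EuclideanSpace ℝ (Fin 3), ∀ x, ‖G (t + 1) x - G t (R x)‖ ≤ η t * ‖x‖)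
    (hreg : ∀ t, ‖(y (t + 1) - y t) - G t (v t)‖ ≤ κ t) (hv : ∀ t, ‖v t‖ ≤ 1) :
    ∃ R : ℕ → (EuclideanSpace ℝ (Fin 3) →ₗᵢ[ℝ] EuclideanSpace ℝ (Fin 3)),
      (∀ t x, ‖G t x - G 0 (R t x)‖ ≤ (∑ s ∈ range t, η s) * ‖x‖) ∧
      ∀ L, ‖(y L - y 0) - G 0 (∑ t ∈ range L, R t (v t))‖ ≤ ∑ t ∈ range L, (κ t + ∑ s ∈ range t, η s) := by
  choose R hR using transport_chain hstep
  exact ⟨R, hR, position_chain (R := fun t => R t) (δ := fun t => ∑ s ∈ range t, η s) hreg hv hR⟩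

/-- Arithmetic of the constant budget: `Σ_{t<L} (κ + t·η) ≤ L·κ + (L²/2)·η` for `0 ≤ η`. [this file] -/
theorem sum_const_add_linear_le {κ η : ℝ} (hη : 0 ≤ η) :
    ∀ L : ℕ, ∑ t ∈ range L, (κ + t * η) ≤ L * κ + (L : ℝ) ^ 2 / 2 * η := by
  intro L
  induction L with
  | zero => simp
  | succ L ih =>
    rw [sum_range_succ]
    push_cast
    nlinarith [ih, hη]

/-- ★★ **RECORD FORM of the chain budget** (memo NODE-g79 §5 ADDENDUM 7/8).  Constant per-step transport error `η` and registration error `κ`: exact isometries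
`R t` with frame op-error `t·η` at chain length `t`, and the site at chain length `L` within `L·κ + (L²/2)·η` of the `G 0`-image of its transported letter sum.
(At `(ε, θ) = (10⁻⁴, 10⁻³)`: `η = (5/2)·(2ε·s + ε·s')`, `κ = ε·s`.) [this file] -/
theorem chain_budget_const {G : ℕ → (EuclideanSpace ℝ (Fin 3) →ₗ[ℝ] EuclideanSpace ℝ (Fin 3))} {η κ : ℝ} (hη : 0 ≤ η)
    {y v : ℕ → EuclideanSpace ℝ (Fin 3)}
    (hstep : ∀ t, ∃ R : EuclideanSpace ℝ (Fin 3) →ₗᵢ[ℝ] EuclideanSpace ℝ (Fin 3), ∀ x, ‖G (t + 1) x - G t (R x)‖ ≤ η * ‖x‖)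
    (hreg : ∀ t, ‖(y (t + 1) - y t) - G t (v t)‖ ≤ κ) (hv : ∀ t, ‖v t‖ ≤ 1) :
    ∃ R : ℕ → (EuclideanSpace ℝ (Fin 3) →ₗᵢ[ℝ] EuclideanSpace ℝ (Fin 3)),
      (∀ t x, ‖G t x - G 0 (R t x)‖ ≤ t * η * ‖x‖) ∧
      ∀ L : ℕ, ‖(y L - y 0) - G 0 (∑ t ∈ range L, R t (v t))‖ ≤ L * κ + (L : ℝ) ^ 2 / 2 * η := by
  obtain ⟨R, hR, hP⟩ := transport_positions (η := fun _ => η) (κ := fun _ => κ) hstep hreg hv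
  refine ⟨R, fun t x => ?_, fun L => ?_⟩
  · have := hR t x
    simpa [sum_const, card_range, nsmul_eq_mul] using this
  · have h1 := hP L
    have h2 : ∑ t ∈ range L, (κ + ∑ s ∈ range t, η) = ∑ t ∈ range L, (κ + (t : ℝ) * η) := by
      refine sum_congr rfl fun t _ => ?_
      simp [sum_const, card_range, nsmul_eq_mul]
    rw [h2] at h1
    exact h1.trans (sum_const_add_linear_le hη L)

end Summit.AtomisticToContinuum.Crystallization.Theorems.OverbindingBudgetAffineCompressedCutChain
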